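import Literature.NumberTheory.EllipticCurves.ZpExtensionEisensteinDVRSettingBookkeepingProofs
import Literature.NumberTheory.EllipticCurves.ZpExtensionEisensteinTwistFreeProofs
import Literature.NumberTheory.EllipticCurves.ZpExtensionScalarTwistFiniteProofs
import Literature.NumberTheory.EllipticCurves.GaloisActionProofs
import Literature.NumberTheory.GaloisCohomology.Howard2004.FiniteSingularTameAdmissible
import HarnessLib

/-!
# The Eisenstein `DVRSetting` of the curve with the TAME finite–singular slots: `fs_admissible` and `fs_natural`

Topic `NumberTheory/EllipticCurves` (D1 road of cell `pub/bsd-print-x9`; companion of `ZpExtensionEisensteinDVRSetting`,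
consumer of lit's tranche (n1) `Howard2004/FiniteSingularTame[Admissible]`).  Definitions with bodies + theorems; no
named fact, no instance, no notation, no `sorry`.

Howard, Def. 1.1.8 / Def. 1.2.3 [arXiv:1202.6340 p. 5 L126–131, p. 6 L126 – p. 7 L12]: the finite–singular comparison
maps `φ^{fs}_ℓ : H¹_f(K_λ, T/I_nT) ≅ H¹_s(K_λ, T/I_nT) ⊗ G_ℓ` are CANONICAL (evaluation at Frobenius, then
`c ⊗ α ↦ c(σ_α)`).  The tree's `TamePin.fs` (lit, p650459) is their tame reading at a pinned tame generator /
Frobenius lift / generator of `k_λˣ`; `tameSlot` fills a `LevelData` slot with it wherever the local action is trivial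
and `(q_λ − 1)·(T/I_nT) = 0` (`TameHyp`), with `0` elsewhere.  For a TOWER the dichotomy must be made UNIFORMLY IN
THE LEVEL (the field `SatisfiesH.fs_natural` compares the slots of consecutive levels at EVERY `(n, v)`; a level-wise
dichotomy can disagree between levels off the Kolyvagin locus).  This file:
* `WeierstrassCurve.eisensteinTameFs π k n v` — the slot of the curve's Eisenstein setting at tower level `k`: Howard's
  map with the pin `π v` if `TameHyp` holds at `(n, v)` at EVERY level, else `0`
  (`eisensteinTameFs_eq_of`, `eisensteinTameFs_eq_zero_of`);
* **`WeierstrassCurve.eisensteinDVRSettingTame`** — `eisensteinDVRSetting` with `fs := eisensteinTameFs π` (the `fs`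
  parameter DISCHARGED; `cd`, `D`, `𝓛`, `S`, `jbar`, `π` remain the caller's);
* `eisensteinTameHyp_of_mem_levels` — at `λ ∈ n ∈ 𝓝(𝓛)` the hypotheses hold at every level (H.0 for
  `E_K[p^{k+1}] ⊗ A_{m,k+1}`, `howardH0_twisted_geomTorsion`; lit's `tameHyp_of_mem_level`);
* **`eisensteinDVRSettingTame_fs_admissible`** — the field `SatisfiesH.fs_admissible` (bijective on `H¹_f`, natural in
  the module, at the Kolyvagin locus: lit's `TamePin.fs_bijective_unramified` / `fs_natural`);
* **`eisensteinDVRSettingTame_fs_natural`** — the field `SatisfiesH.fs_natural` (along the tower reductions, at EVERY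
  `(n, v)`: on the uniform-`TameHyp` locus by `TamePin.fs_natural` — `rqLocH1` IS lit's `localH1Map` of `rq` and `fsQ` IS
  `singularQuotientMap`, definitionally —, off it `0 = 0`).
Every statement about the setting carries the CONSUMER PREAMBLE of `ZpExtensionEisensteinDVRSetting`.  BSD is not proved.

References: [Howard2004HeegnerKolyvagin] Prop. 1.1.7, Def. 1.1.8, Def. 1.2.1–1.2.3 (arXiv pp. 5–7), §1.6 (p. 11 L13–38);
[MazurRubinMemoirs2004] Def. 1.2.2, Lemma 1.2.1; [Kim2022StructureSelmer] §2.2.2; [SerreLocalFields1979] XIII §1.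
-/

set_option autoImplicit false

noncomputable section

open Function NumberField IsDedekindDomain Field
open scoped NumberField ContRepresentation TensorProduct Classical

namespace Literature.NumberTheory.GaloisCohomology.Howard2004.LevelData

open Literature.NumberTheory.GaloisRepresentations
open Literature.NumberTheory.GaloisRepresentations.DiscreteGaloisModule

variable {K : Type} [Field K] [NumberField K]
  {M : Type} [AddCommGroup M] [TopologicalSpace M] [DiscreteTopology M] {R : Type} [CommRing R] [Module R M]
  {p : ℕ} {ρ : DiscreteGaloisModule K M} {t : SelmerTriple p ρ}
  {N : Finset (HeightOneSpectrum (𝓞 K)) → Type} [∀ n, AddCommGroup (N n)]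
  [∀ n, TopologicalSpace (N n)] [∀ n, DiscreteTopology (N n)] [∀ n, Module R (N n)]
  {M' : Type} [AddCommGroup M'] [TopologicalSpace M'] [DiscreteTopology M'] {R' : Type} [CommRing R'] [Module R' M']
  {ρ' : DiscreteGaloisModule K M'} {t' : SelmerTriple p ρ'}
  {N' : Finset (HeightOneSpectrum (𝓞 K)) → Type} [∀ n, AddCommGroup (N' n)]
  [∀ n, TopologicalSpace (N' n)] [∀ n, DiscreteTopology (N' n)] [∀ n, Module R' (N' n)]

/-- **A level datum whose slot is the tame map on a locus `U` containing the Kolyvagin locus (and `0` elsewhere) is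
`IsFsAdmissible`** — the generic form of lit's `isFsAdmissible_of_fs_eq_tameSlot` for a slot defined by an arbitrary
dichotomy `U n v` implying `TameHyp` (used below with `U` = «`TameHyp` at every level of a tower»).
[cite: Howard2004HeegnerKolyvagin, Def. 1.1.8 and Def. 1.2.3 (arXiv p. 5 L126–149, p. 6 L126 – p. 7 L12)] -/
theorem isFsAdmissible_of_fs_eq_dite [Fact p.Prime] [∀ n, Finite (N n)] (D : LevelData R ρ t N)
    (π : ∀ v : HeightOneSpectrum (𝓞 K), TamePin v)
    (U : Finset (HeightOneSpectrum (𝓞 K)) → HeightOneSpectrum (𝓞 K) → Prop)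
    (hU : ∀ {n : Finset (HeightOneSpectrum (𝓞 K))} {v : HeightOneSpectrum (𝓞 K)}, U n v → TameHyp D.ρq n v)
    (hfs : ∀ (n : Finset (HeightOneSpectrum (𝓞 K))) (v : HeightOneSpectrum (𝓞 K)),
      D.fs n v = if h : U n v then (π v).fs (GaloisRep.toLocal v (D.ρq n)) (hU h).1 (hU h).2 else 0)
    (hlev : ∀ n ∈ t.levelSet, ∀ v ∈ n, U n v) : D.IsFsAdmissible := by
  intro n hn v hv
  have h := hlev n hn v hv
  refine ⟨?_, fun n' hn' hv' ↦ ?_⟩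
  · unfold FsBijectiveAt
    simp_rw [hfs n v, dif_pos h]
    exact (π v).fs_bijective_unramified (GaloisRep.toLocal v (D.ρq n)) (hU h).1 (hU h).2
      (natCard_gell_smul_eq_zero_of_mem_level D hn hv)
  · have h' := hlev n' hn' v hv'
    intro g hg c _
    rw [hfs n' v, hfs n v, dif_pos h, dif_pos h']
    exact (π v).fs_natural (D.ρq n) (D.ρq n') g.toAddMonoidHom hg (hU h).1 (hU h').1 (hU h).2 (hU h').2 c

/-- **Two level data (e.g. consecutive levels of a tower) whose slots are the tame maps on the SAME locus `U` (and `0`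
elsewhere) have compatible slots along any locally equivariant additive map `r`**: `fs (H¹(r) x) = (H¹_s(r) ⊗ 1)(fs' x)`
at every `(n, v)` (on `U` by naturality of the tame map in the module, off `U` both vanish).
[cite: Howard2004HeegnerKolyvagin, Prop. 1.1.7 / Def. 1.1.8 and §1.6 (arXiv p. 5 L115–149, p. 11 L49–50)] -/
theorem fs_localH1Map_of_fs_eq_dite [∀ n, Finite (N n)] [∀ n, Finite (N' n)]
    (D : LevelData R ρ t N) (D' : LevelData R' ρ' t' N') (π : ∀ v : HeightOneSpectrum (𝓞 K), TamePin v)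
    (U : Finset (HeightOneSpectrum (𝓞 K)) → HeightOneSpectrum (𝓞 K) → Prop)
    (hU : ∀ {n : Finset (HeightOneSpectrum (𝓞 K))} {v : HeightOneSpectrum (𝓞 K)}, U n v → TameHyp D.ρq n v)
    (hU' : ∀ {n : Finset (HeightOneSpectrum (𝓞 K))} {v : HeightOneSpectrum (𝓞 K)}, U n v → TameHyp D'.ρq n v)
    (hfs : ∀ (n : Finset (HeightOneSpectrum (𝓞 K))) (v : HeightOneSpectrum (𝓞 K)),
      D.fs n v = if h : U n v then (π v).fs (GaloisRep.toLocal v (D.ρq n)) (hU h).1 (hU h).2 else 0)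
    (hfs' : ∀ (n : Finset (HeightOneSpectrum (𝓞 K))) (v : HeightOneSpectrum (𝓞 K)),
      D'.fs n v = if h : U n v then (π v).fs (GaloisRep.toLocal v (D'.ρq n)) (hU' h).1 (hU' h).2 else 0)
    (n : Finset (HeightOneSpectrum (𝓞 K))) (v : HeightOneSpectrum (𝓞 K)) (r : N' n →+ N n)
    (hr : ∀ (σ : absoluteGaloisGroup (v.adicCompletion K)) (y : N' n),
      r (GaloisRep.toLocal v (D'.ρq n) σ y) = GaloisRep.toLocal v (D.ρq n) σ (r y))
    (x : galoisCohomology (GaloisRep.toLocal v (D'.ρq n)) 1) :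
    D.fs n v (localH1Map (D'.ρq n) (D.ρq n) v r hr x) =
      TensorProduct.map (singularQuotientMap (D'.ρq n) (D.ρq n) v r hr).toIntLinearMap LinearMap.id (D'.fs n v x) := by
  by_cases h : U n v
  · rw [hfs n v, hfs' n v, dif_pos h, dif_pos h]
    exact (π v).fs_natural (D'.ρq n) (D.ρq n) r hr (hU' h).1 (hU h).1 (hU' h).2 (hU h).2 x
  · rw [hfs n v, hfs' n v, dif_neg h, dif_neg h]
    exact (map_zero (TensorProduct.map (singularQuotientMap (D'.ρq n) (D.ρq n) v r hr).toIntLinearMap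
      (LinearMap.id (R := ℤ) (M := Gell v)))).symm

end Literature.NumberTheory.GaloisCohomology.Howard2004.LevelData

namespace WeierstrassCurve

open Literature.NumberTheory.EllipticCurves Literature.NumberTheory.GaloisRepresentations
open Literature.NumberTheory.GaloisRepresentations.DiscreteGaloisModule
open Literature.NumberTheory.GaloisCohomology.Howard2004
open Literature.NumberTheory.EllipticCurves.ZpExtension (EisensteinLevel)

variable {K : Type} [Field K] [NumberField K] (W : WeierstrassCurve ℚ) [W.IsElliptic] {p : ℕ} [hp : Fact p.Prime]
  (κ : ZpExtension K p) {m : ℕ} (hm : 1 ≤ m)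

include hm in
/-- The levels `T^{(k)} = E_K[p^{k+1}] ⊗ A_{m,k+1}` are finite (`finite_twisted`, `finite_torsionPoints_holds`).
[cite: Howard2004HeegnerKolyvagin, §2.2 (T_𝔮/p^k T_𝔮 finite)] [cite: SilvermanAEC2009, Cor. III.6.4] -/
theorem finite_eisensteinLevel (k : ℕ) : Finite (EisensteinLevel p m (fun j ↦ geomTorsion (W.baseChange K) ((p : ℤ) ^ j)) (k + 1)) := by
  haveI : Finite (geomTorsion (W.baseChange K) ((p : ℤ) ^ (k + 1))) :=
    finite_torsionPoints_holds (W.baseChange K) (AlgebraicClosure K)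
      (pow_ne_zero _ (by exact_mod_cast hp.out.ne_zero))
  exact IwasawaAlgebra.EisensteinCoeff.finite_twisted (p := p) (k := k + 1) hm

/-- The canonical Kolyvagin quotients `T^{(k)} ⧸ I_n • T^{(k)}` are finite. [cite: Howard2004HeegnerKolyvagin, Def. 1.2.3 (arXiv p. 7, L1–6)] -/
theorem finite_eisensteinLevelQuotCarrier (k : ℕ) (n : Finset (HeightOneSpectrum (𝓞 K))) :
    letI := IwasawaAlgebra.isLocalRing_quotient_X_pow_add_C p hm
    Finite (LevelData.QuotCarrier (IwasawaAlgebra.EisensteinCoeff p m (k + 1)) ((W.eisensteinTower κ hm).ρ k) n) := by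
  haveI := W.finite_eisensteinLevel (K := K) (p := p) hm k
  exact Finite.of_surjective (Submodule.mkQ _) (Submodule.mkQ_surjective _)

variable (π : ∀ v : HeightOneSpectrum (𝓞 K), TamePin v)

/-- **The tame finite–singular slot of the curve's Eisenstein setting at tower level `k`**, UNIFORM in the level: at
`(n, v)` where `TameHyp` (trivial local action, `(q_v − 1)`-torsion) holds for the Kolyvagin quotient `T^{(j)}/I_n` of
EVERY level `j`, Howard's comparison map with the pin `π v` (`TamePin.fs`); elsewhere `0`.
[cite: Howard2004HeegnerKolyvagin, Def. 1.1.8 / Def. 1.2.3 (arXiv p. 5 L144–149, p. 6 L126–131)] [cite: Kim2022StructureSelmer, §2.2.2] -/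
def eisensteinTameFs (k : ℕ) (n : Finset (HeightOneSpectrum (𝓞 K))) (v : HeightOneSpectrum (𝓞 K)) :
    letI := IwasawaAlgebra.isLocalRing_quotient_X_pow_add_C p hm
    galoisCohomology ((W.eisensteinLevelQuot κ hm k n).toLocal (Sum.inr v)) 1 →+
      SingularQuotient (GaloisRep.toLocal v (W.eisensteinLevelQuot κ hm k n)) ⊗[ℤ] Gell v :=
  letI := IwasawaAlgebra.isLocalRing_quotient_X_pow_add_C p hm
  haveI := W.finite_eisensteinLevelQuotCarrier (K := K) (p := p) κ hm k n
  if h : ∀ j, TameHyp (fun n ↦ W.eisensteinLevelQuot κ hm j n) n v then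
    (π v).fs (GaloisRep.toLocal v (W.eisensteinLevelQuot κ hm k n)) (h k).1 (h k).2
  else 0

/-- On the uniform-`TameHyp` locus the slot is Howard's map with the pin `π v`.
[cite: Howard2004HeegnerKolyvagin, Def. 1.1.8 (arXiv p. 5, L144–149)] -/
theorem eisensteinTameFs_eq_of (k : ℕ) {n : Finset (HeightOneSpectrum (𝓞 K))} {v : HeightOneSpectrum (𝓞 K)}
    (h : letI := IwasawaAlgebra.isLocalRing_quotient_X_pow_add_C p hm
      ∀ j, TameHyp (fun n ↦ W.eisensteinLevelQuot κ hm j n) n v) :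
    letI := IwasawaAlgebra.isLocalRing_quotient_X_pow_add_C p hm
    haveI := W.finite_eisensteinLevelQuotCarrier (K := K) (p := p) κ hm k n
    W.eisensteinTameFs κ hm π k n v = (π v).fs (GaloisRep.toLocal v (W.eisensteinLevelQuot κ hm k n)) (h k).1 (h k).2 :=
  dif_pos h

/-- Off the uniform-`TameHyp` locus the slot is `0` (at every level). [cite: Howard2004HeegnerKolyvagin, Def. 1.2.3 (arXiv p. 6, L126–131: the slot is only used at λ ∈ n)] -/
theorem eisensteinTameFs_eq_zero_of (k : ℕ) {n : Finset (HeightOneSpectrum (𝓞 K))} {v : HeightOneSpectrum (𝓞 K)}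
    (h : letI := IwasawaAlgebra.isLocalRing_quotient_X_pow_add_C p hm
      ¬ ∀ j, TameHyp (fun n ↦ W.eisensteinLevelQuot κ hm j n) n v) :
    letI := IwasawaAlgebra.isLocalRing_quotient_X_pow_add_C p hm
    W.eisensteinTameFs κ hm π k n v = 0 :=
  dif_neg h

variable (S : Finset (HeightOneSpectrum (𝓞 K)))
  (hpS : ∀ v : HeightOneSpectrum (𝓞 K), ((p : ℕ) : 𝓞 K) ∈ v.asIdeal → v ∈ S)
  (hbad : ∀ v : HeightOneSpectrum (𝓞 K), v ∉ S → ((p : ℕ) : 𝓞 K) ∉ v.asIdeal → (W.baseChange K).HasGoodReductionAt v)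
  (L : Set (HeightOneSpectrum (𝓞 K)))
  (hL : letI := IwasawaAlgebra.isLocalRing_quotient_X_pow_add_C p hm
    L ⊆ (W.eisensteinTower κ hm).degreeTwoPrimes p)
  (hLS : ∀ v ∈ L, v ∉ S)
  (jbar : AlgebraicClosure K →+* ℂ) (cd : ConjugationDatum K)
  (D : letI := IwasawaAlgebra.isLocalRing_quotient_X_pow_add_C p hm
    ∀ k, DualityDatum p cd ((W.eisensteinTower κ hm).ρ k) (IwasawaAlgebra.EisensteinCoeff p m (k + 1)))

set_option synthInstance.maxHeartbeats 80000 in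
/-- **The Eisenstein specialisation of `E_K` with the TAME finite–singular slots** — Howard's §1.6 data for the curve with
the `fs` slot discharged by (the tame reading of) the canonical comparison maps of Def. 1.1.8.
[cite: Howard2004HeegnerKolyvagin, §1.6 (arXiv p. 11 L13–38), Def. 1.1.8, Def. 1.2.3] -/
def eisensteinDVRSettingTame :
    letI := IwasawaAlgebra.isDomain_quotient_X_pow_add_C p hm
    letI := IwasawaAlgebra.isDiscreteValuationRing_quotient_X_pow_add_C p hm
    haveI := IwasawaAlgebra.EisensteinCoeff.isLocalRing_succ p hm
    letI := IwasawaAlgebra.EisensteinCoeff.algebraOfSpecSucc p m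
    haveI := W.isScalarTower_algebraOfSpecSucc (K := K) (p := p) (m := m)
    letI := W.residueModuleSucc (K := K) (p := p) hm
    DVRSetting p K (IwasawaAlgebra p ⧸
        Ideal.span {(PowerSeries.X ^ m + PowerSeries.C (p : ℤ_[p]) : IwasawaAlgebra p)})
      (fun k ↦ EisensteinLevel p m (fun j ↦ geomTorsion (W.baseChange K) ((p : ℤ) ^ j)) (k + 1))
      (fun k ↦ IwasawaAlgebra.EisensteinCoeff p m (k + 1)) (geomTorsion (W.baseChange K) (p : ℤ))
      (fun k n ↦ LevelData.QuotCarrier (IwasawaAlgebra.EisensteinCoeff p m (k + 1)) ((W.eisensteinTower κ hm).ρ k) n) :=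
  W.eisensteinDVRSetting κ hm S hpS hbad L hL hLS jbar cd D (W.eisensteinTameFs κ hm π)

set_option synthInstance.maxHeartbeats 80000 in
/-- Unfolding: the tame setting IS `eisensteinDVRSetting` at `fs := eisensteinTameFs π` (so every `eisensteinDVRSetting_*`
theorem applies to it). [cite: Howard2004HeegnerKolyvagin, §1.6 (arXiv p. 11 L13–38)] -/
theorem eisensteinDVRSettingTame_eq :
    letI := IwasawaAlgebra.isDomain_quotient_X_pow_add_C p hm
    letI := IwasawaAlgebra.isDiscreteValuationRing_quotient_X_pow_add_C p hm
    haveI := IwasawaAlgebra.EisensteinCoeff.isLocalRing_succ p hm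
    letI := IwasawaAlgebra.EisensteinCoeff.algebraOfSpecSucc p m
    haveI := W.isScalarTower_algebraOfSpecSucc (K := K) (p := p) (m := m)
    letI := W.residueModuleSucc (K := K) (p := p) hm
    (W.eisensteinDVRSettingTame κ hm π S hpS hbad L hL hLS jbar cd D) = W.eisensteinDVRSetting κ hm S hpS hbad L hL hLS jbar cd D (W.eisensteinTameFs κ hm π) :=
  rfl

set_option synthInstance.maxHeartbeats 80000 in
/-- The finite–singular slots of the tame setting are `eisensteinTameFs`. [cite: Howard2004HeegnerKolyvagin, Def. 1.2.3 (arXiv p. 6, L126–131)] -/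
theorem eisensteinDVRSettingTame_LD_fs (k : ℕ) :
    letI := IwasawaAlgebra.isDomain_quotient_X_pow_add_C p hm
    letI := IwasawaAlgebra.isDiscreteValuationRing_quotient_X_pow_add_C p hm
    haveI := IwasawaAlgebra.EisensteinCoeff.isLocalRing_succ p hm
    letI := IwasawaAlgebra.EisensteinCoeff.algebraOfSpecSucc p m
    haveI := W.isScalarTower_algebraOfSpecSucc (K := K) (p := p) (m := m)
    letI := W.residueModuleSucc (K := K) (p := p) hm
    ((W.eisensteinDVRSettingTame κ hm π S hpS hbad L hL hLS jbar cd D).LD k).fs = W.eisensteinTameFs κ hm π k :=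
  rfl

set_option synthInstance.maxHeartbeats 80000 in
/-- **At `λ ∈ n ∈ 𝓝(𝓛)` the tame hypotheses hold at EVERY level** (`Γ_{K_λ}` acts trivially on `T^{(j)}/I_n T^{(j)}` and
`(q_λ − 1)·(T^{(j)}/I_n) = 0`: H.0 for `E_K[p^{j+1}] ⊗ A_{m,j+1}` and lit's `tameHyp_of_mem_level`).
[cite: Howard2004HeegnerKolyvagin, Def. 1.2.1, Def. 1.2.3 and H.0 (arXiv p. 6 L57–75, p. 7 L57)] -/
theorem eisensteinTameHyp_of_mem_levels {n : Finset (HeightOneSpectrum (𝓞 K))} (hn : n ∈ levels L)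
    {v : HeightOneSpectrum (𝓞 K)} (hv : v ∈ n) (j : ℕ) :
    letI := IwasawaAlgebra.isDomain_quotient_X_pow_add_C p hm
    letI := IwasawaAlgebra.isDiscreteValuationRing_quotient_X_pow_add_C p hm
    haveI := IwasawaAlgebra.EisensteinCoeff.isLocalRing_succ p hm
    letI := IwasawaAlgebra.EisensteinCoeff.algebraOfSpecSucc p m
    haveI := W.isScalarTower_algebraOfSpecSucc (K := K) (p := p) (m := m)
    letI := W.residueModuleSucc (K := K) (p := p) hm
    TameHyp ((W.eisensteinDVRSettingTame κ hm π S hpS hbad L hL hLS jbar cd D).LD j).ρq n v := by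
  letI := IwasawaAlgebra.isDomain_quotient_X_pow_add_C p hm
  letI := IwasawaAlgebra.isDiscreteValuationRing_quotient_X_pow_add_C p hm
  haveI := IwasawaAlgebra.EisensteinCoeff.isLocalRing_succ p hm
  letI := IwasawaAlgebra.EisensteinCoeff.algebraOfSpecSucc p m
  haveI := W.isScalarTower_algebraOfSpecSucc (K := K) (p := p) (m := m)
  letI := W.residueModuleSucc (K := K) (p := p) hm
  have hpK : (p : K) ≠ 0 := by exact_mod_cast hp.out.ne_zero
  have h0 : H0 (IwasawaAlgebra.EisensteinCoeff p m (j + 1)) (EisensteinLevel p m (fun j ↦ geomTorsion (W.baseChange K) ((p : ℤ) ^ j)) (j + 1)) :=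
    (W.baseChange K).howardH0_twisted_geomTorsion (p := p) (m := m) hpK hm (k := j + 1) j.succ_pos
  exact tameHyp_of_mem_level ((W.eisensteinDVRSettingTame κ hm π S hpS hbad L hL hLS jbar cd D).LD j) hn hv
    fun σ hσ x ↦ ((W.eisensteinDVRSettingTame κ hm π S hpS hbad L hL hLS jbar cd D).LD j).ρq_apply_eq_self_of_h0 h0 hv hσ x

set_option synthInstance.maxHeartbeats 80000 in
/-- **`SatisfiesH.fs_admissible` for the tame Eisenstein setting**: at every tower level the slot is bijective on the
finite classes and natural in the module at every `λ ∈ n ∈ 𝓝(𝓛)` — lit's `TamePin.fs_bijective_unramified` /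
`TamePin.fs_natural` on the uniform-`TameHyp` locus.
[cite: Howard2004HeegnerKolyvagin, Def. 1.1.8 and Def. 1.2.3 (arXiv p. 5 L126–149, p. 6 L126 – p. 7 L12)] -/
theorem eisensteinDVRSettingTame_fs_admissible (k : ℕ) :
    letI := IwasawaAlgebra.isDomain_quotient_X_pow_add_C p hm
    letI := IwasawaAlgebra.isDiscreteValuationRing_quotient_X_pow_add_C p hm
    haveI := IwasawaAlgebra.EisensteinCoeff.isLocalRing_succ p hm
    letI := IwasawaAlgebra.EisensteinCoeff.algebraOfSpecSucc p m
    haveI := W.isScalarTower_algebraOfSpecSucc (K := K) (p := p) (m := m)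
    letI := W.residueModuleSucc (K := K) (p := p) hm
    ((W.eisensteinDVRSettingTame κ hm π S hpS hbad L hL hLS jbar cd D).LD k).IsFsAdmissible := by
  letI := IwasawaAlgebra.isDomain_quotient_X_pow_add_C p hm
  letI := IwasawaAlgebra.isDiscreteValuationRing_quotient_X_pow_add_C p hm
  haveI := IwasawaAlgebra.EisensteinCoeff.isLocalRing_succ p hm
  letI := IwasawaAlgebra.EisensteinCoeff.algebraOfSpecSucc p m
  haveI := W.isScalarTower_algebraOfSpecSucc (K := K) (p := p) (m := m)
  letI := W.residueModuleSucc (K := K) (p := p) hm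
  haveI := fun n ↦ W.finite_eisensteinLevelQuotCarrier (K := K) (p := p) κ hm k n
  exact LevelData.isFsAdmissible_of_fs_eq_dite ((W.eisensteinDVRSettingTame κ hm π S hpS hbad L hL hLS jbar cd D).LD k) π
    (fun n v ↦ ∀ j, TameHyp (fun n ↦ W.eisensteinLevelQuot κ hm j n) n v) (fun h ↦ h k) (fun _ _ ↦ rfl)
    fun n hn v hv j ↦ W.eisensteinTameHyp_of_mem_levels κ hm π S hpS hbad L hL hLS jbar cd D hn hv j

set_option synthInstance.maxHeartbeats 80000 in
/-- **`SatisfiesH.fs_natural` for the tame Eisenstein setting**: the slots of consecutive levels are compatible along the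
reduction `T^{(k+1)}/I_n → T^{(k)}/I_n` at EVERY `(n, v)` — on the uniform-`TameHyp` locus by naturality of Howard's map
in the module (`rqLocH1` is lit's `localH1Map` of `rq`, `fsQ` is `singularQuotientMap`, definitionally), off it both
slots vanish. [cite: Howard2004HeegnerKolyvagin, Def. 1.2.3 display (ks relations) and §1.6 (arXiv p. 6 L126–140, p. 11 L49–50)] -/
theorem eisensteinDVRSettingTame_fs_natural (k : ℕ) (n : Finset (HeightOneSpectrum (𝓞 K))) (v : HeightOneSpectrum (𝓞 K))
    (x : letI := IwasawaAlgebra.isLocalRing_quotient_X_pow_add_C p hm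
      galoisCohomology (GaloisRep.toLocal v (W.eisensteinLevelQuot κ hm (k + 1) n)) 1) :
    letI := IwasawaAlgebra.isDomain_quotient_X_pow_add_C p hm
    letI := IwasawaAlgebra.isDiscreteValuationRing_quotient_X_pow_add_C p hm
    haveI := IwasawaAlgebra.EisensteinCoeff.isLocalRing_succ p hm
    letI := IwasawaAlgebra.EisensteinCoeff.algebraOfSpecSucc p m
    haveI := W.isScalarTower_algebraOfSpecSucc (K := K) (p := p) (m := m)
    letI := W.residueModuleSucc (K := K) (p := p) hm
    ((W.eisensteinDVRSettingTame κ hm π S hpS hbad L hL hLS jbar cd D).LD k).fs n v ((W.eisensteinDVRSettingTame κ hm π S hpS hbad L hL hLS jbar cd D).rqLocH1 k n v x) =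
      TensorProduct.map ((W.eisensteinDVRSettingTame κ hm π S hpS hbad L hL hLS jbar cd D).fsQ k n v).toIntLinearMap LinearMap.id (((W.eisensteinDVRSettingTame κ hm π S hpS hbad L hL hLS jbar cd D).LD (k + 1)).fs n v x) := by
  letI := IwasawaAlgebra.isDomain_quotient_X_pow_add_C p hm
  letI := IwasawaAlgebra.isDiscreteValuationRing_quotient_X_pow_add_C p hm
  haveI := IwasawaAlgebra.EisensteinCoeff.isLocalRing_succ p hm
  letI := IwasawaAlgebra.EisensteinCoeff.algebraOfSpecSucc p m
  haveI := W.isScalarTower_algebraOfSpecSucc (K := K) (p := p) (m := m)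
  letI := W.residueModuleSucc (K := K) (p := p) hm
  haveI := fun n ↦ W.finite_eisensteinLevelQuotCarrier (K := K) (p := p) κ hm k n
  haveI := fun n ↦ W.finite_eisensteinLevelQuotCarrier (K := K) (p := p) κ hm (k + 1) n
  exact LevelData.fs_localH1Map_of_fs_eq_dite ((W.eisensteinDVRSettingTame κ hm π S hpS hbad L hL hLS jbar cd D).LD k) ((W.eisensteinDVRSettingTame κ hm π S hpS hbad L hL hLS jbar cd D).LD (k + 1)) π
    (fun n v ↦ ∀ j, TameHyp (fun n ↦ W.eisensteinLevelQuot κ hm j n) n v) (fun h ↦ h k) (fun h ↦ h (k + 1))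
    (fun _ _ ↦ rfl) (fun _ _ ↦ rfl) n v ((W.eisensteinDVRSettingTame κ hm π S hpS hbad L hL hLS jbar cd D).rq k n).toAddMonoidHom
    (fun σ y ↦ (W.eisensteinDVRSettingTame κ hm π S hpS hbad L hL hLS jbar cd D).rq_equivariant k n _ y) x

end WeierstrassCurve

end
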